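import Summits.BirchSwinnertonDyer.BirchSwinnertonDyer.Theorems.PrintCf2RamifiedOffTYZLevelTwoRhoValve
import HarnessLib

/-!
# Route `PrintCf2`, crux stmt-BirchSwinnertonDyer-20509 `RamifiedOffTYZOfFacts` — THEOREM 3.5 WITHOUT `ρ(n)` AND WITHOUT
# `α_n`: `2·P(n) ≡ ±𝓛(n)·Q₁ (mod A(ℍ′_n)_tor)` for any half `Q₁` of the twisted Mordell–Weil generator, and
# C⁺ at `n` ⟺ `P(n)` is an ODD multiple of `Q₁` modulo torsion
# (cell `bsd-print-cf2`, LEAD of 20509 g3, line `offtyz-v7`, lineage cycle 4, sequel of `…LevelTwoRhoValve`; fact-free,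
# Theses-free, no `def`)

HONEST FRAMING (cell `bsd-print-cf2`; route `PrintCf2`; crux 20509 = `𝔅_ram → WAllCornerFTwoRamifiedOffTYZProved`, DECIDING,
OPEN AS A CLASS): bookkeeping on Tian–Yuan–Zhang's Theorem 3.5 main clause taken as a HYPOTHESIS on the displayed data
(`D.thm35Main`, `D.scriptLSpec` on `D : GenusPointData n`) plus the tree's own `2`-descent algebra (W2 kernel) — nothing
asserted, no named fact introduced.  C⁺ = `stub_offTYZ_levelTwoScriptLExact` (`2 ∥ 𝓛(n)` on the jump-one rank-one class;
OPEN, NO PRINT) stays open.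

The printed main clause reads `2^{1+ρ(n)}·P(n) ≡ ±𝓛(n)·α_n` modulo torsion, with TWO auxiliary objects: the index
`2^{ρ(n)} = [E_n(ℚ) : φ_n(A_n(ℚ)) + E_n[2]]` and a generator `α_n` of the free part of `A(K_n)⁻`.  The half relation of
`…LevelTwoRhoValve` (`ι Θ_A(α₀) ≡ ±2^ρ·Q₁`) ELIMINATES BOTH:

* §2 `two_smul_genusPoint_sub_smul_half_isOfFinAddOrder` (**Thm 3.5, `ρ`-free and `α`-free**): for square-free `n` with
  `rank E_n(ℚ) ≤ 1` and `𝓛(n) ≠ 0`, `R` a generator of `E_n(ℚ)` modulo torsion and `Q₁ ∈ A(ℍ′_n)` ANY point with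
  `φ_H(Q₁) = ι Θ_E(R)` (a half of the twisted generator; exists by `W2.twist_halving`):
  **`2·P(n) − (u·𝓛(n))·Q₁ ∈ A(ℍ′_n)_tor` with `u = ±1`.**  So `𝓛(n)` is TWICE the index of the genus point `P(n)` relative
  to `Q₁` in `A(ℍ′_n)/tors`, whatever `ρ(n)` is (it cancels against the valve: `d(α_n) = ρ(n) + d(Q₁)`).
* §2 `levelTwo_iff_genusPoint_odd_multiple_half` (**C⁺ in `E_n(ℚ)`-currency**): granted GZK on the rank-one class,
  **C⁺ at `n` ⟺ `P(n) ≡ m·Q₁ (mod A(ℍ′_n)_tor)` for some ODD `m`** — g0's reading with `(2^ρ, α_n)` replaced by `(1, Q₁)`.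
* §3 consequences: C⁺ at `n` ⟹ `P(n)` and `Q₁` have the SAME `2`-adic depth in `A(ℍ′_n)` modulo torsion
  (`twoPowDivisible_iff_of_levelTwo`, every `k`); on the visible part `[Q₁] ≠ 0`:
  **C⁺ at `n` ⟺ `[P(n)] = [Q₁]`** in `V = A(ℍ′_n)/(2A(ℍ′_n) + A(ℍ′_n)_tor)` (`levelTwo_iff_genusPoint_sub_half_twoDivisible`)
  — sharper than g2's `[P(n)] ≠ 0`; and `𝓛(n)` odd ⟹ `[Q₁] = 0` (`half_twoDivisible_of_odd_scriptL`: the TYZ-proved families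
  sit in the hidden part of this bookkeeping, consistently).

What this buys the line (LEAD census, crux 20509): the level-two target no longer mentions `ρ(n)` or `A(K_n)⁻`: it is a
statement about THREE objects in `A(ℍ′_n)/tors` — the genus point `P(n)` (equivalently, on even weights, the genus period
`Z(n)`, g2's sequel), the half `Q₁` of the Mordell–Weil generator of `E_n(ℚ)`, and the prime `2` — namely «`P(n) ∈ ℤ_{(2)}^×·Q₁`».
Beyond-print theorem: NO (bookkeeping of a printed clause); C⁺ itself stays open.  BSD is not proved by any of this; no class
is closed by this file.

References: [cite: TianYuanZhang2017, Thm. 3.5 (arXiv:1411.4728 chunk p0011 L94–L100), §3.1 (p0011 L27–L36), §1 (p0002 L101–L110)];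
[cite: SilvermanAEC2009, Prop. X.4.9]; [cite: Darmon2004, Thm. 3.22] (GZK, binder `hGZK`); tree: `…LevelTwoRhoValve` (g3),
`…LevelTwoModTwo` (g2), `…LevelTwoGenusPoint` (g0), `TianYuanZhang2017/GenusDescent{Defs,Twist,EnSide}.lean` (W2 kernel).
-/

noncomputable section

open scoped Classical

open WeierstrassCurve WeierstrassCurve.Affine Literature.NumberTheory.EllipticCurves
  Literature.NumberTheory.EllipticCurves.Rank1Residual Summit.BirchSwinnertonDyer.Rank1Residual
  Literature.NumberTheory.EllipticCurves.TianYuanZhang2017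
  Literature.NumberTheory.EllipticCurves.TianYuanZhang2017.W2

set_option autoImplicit false

namespace Summit.BirchSwinnertonDyer.PrintCf2.LevelTwoHalfGenerator

/-! ## §1 Abstract: an odd multiple has the same `2`-adic depth modulo torsion -/

section Abstract

variable {G : Type*} [AddCommGroup G]

/-- An odd integer is coprime to every power of `2`. [folklore] -/
theorem isCoprime_two_pow_of_odd {c : ℤ} (hc : Odd c) (k : ℕ) : IsCoprime c ((2 : ℤ) ^ k) := by
  obtain ⟨j, rfl⟩ := hc
  have h2 : IsCoprime (2 * j + 1) (2 : ℤ) := ⟨1, -j, by ring⟩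
  exact h2.pow_right

/-- `x ≡ c·z` modulo torsion with `c` ODD: `x ∈ 2^k G + G_tor ⟺ z ∈ 2^k G + G_tor` (Bezout `a·c + b·2^k = 1`). [folklore] -/
theorem twoPowDivisible_iff_of_odd_zsmul {x z : G} {c : ℤ} (hc : Odd c) (h : IsOfFinAddOrder (x - c • z)) (k : ℕ) :
    (∃ y : G, IsOfFinAddOrder (x - ((2 : ℤ) ^ k) • y)) ↔ ∃ y : G, IsOfFinAddOrder (z - ((2 : ℤ) ^ k) • y) := by
  constructor
  · rintro ⟨y, hy⟩
    obtain ⟨a, b, hab⟩ := isCoprime_two_pow_of_odd hc k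
    refine ⟨a • y + b • z, ?_⟩
    have e : z - ((2 : ℤ) ^ k) • (a • y + b • z) =
        (1 - (a * c + b * 2 ^ k)) • z + a • (x - ((2 : ℤ) ^ k) • y) + (-a) • (x - c • z) := by
      module
    rw [e, hab, sub_self, zero_smul, zero_add]
    exact hy.zsmul.add h.zsmul
  · rintro ⟨y, hy⟩
    refine ⟨c • y, ?_⟩
    have e : x - ((2 : ℤ) ^ k) • (c • y) = (x - c • z) + c • (z - ((2 : ℤ) ^ k) • y) := by module
    rw [e]
    exact h.add hy.zsmul

/-- `x ≡ m·z` modulo torsion with `m` odd ⟹ `x − z ∈ 2G + G_tor`. [folklore] -/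
theorem sub_twoDivisible_of_odd_zsmul {x z : G} {m : ℤ} (hm : Odd m) (h : IsOfFinAddOrder (x - m • z)) :
    ∃ y : G, IsOfFinAddOrder (x - z - (2 : ℤ) • y) := by
  obtain ⟨j, rfl⟩ := hm
  refine ⟨j • z, ?_⟩
  have e : x - z - (2 : ℤ) • (j • z) = x - (2 * j + 1) • z := by module
  rwa [e]

end Abstract

/-! ## §2 Thm 3.5 on `E_n` without `ρ(n)` and without `α_n`; C⁺ ⟺ `P(n)` is an odd multiple of `Q₁` -/

section EnSide

variable {n : ℕ}

/-- `Θ_E : E_n(ℚ) → A₂(K_n)` is injective (a composite of bijections and the injective base change), hence reflects finite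
order. [cite: TianYuanZhang2017, §3.1 (chunk p0011 L27–L36) with §1 (p0002 L101–L110)] -/
theorem ΘE_injective (hn : n ≠ 0) [(congruentNumberCurve n).IsElliptic] : Function.Injective (ΘE hn) := fun _ _ h =>
  ((VariableChange.pointEquiv (congruentNumberCurve n) CE).trans
      (Affine.Point.congrEquiv (CE_smul (n := n)))).injective
    (ιK_injective _ _ ((untwistEquivAt curveA.twoIsogenyCodomain (θn_sq hn) (θn_ne_zero hn)).injective h))

/-- A half `Q₁` of the twisted image of a NON-torsion rational point `R` is non-torsion (`φ_H`, `ι`, `Θ_E` are injective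
homomorphisms). [cite: TianYuanZhang2017, §3.1 (chunk p0011 L27–L36)] -/
theorem not_isOfFinAddOrder_half (hsq : Squarefree n) [(congruentNumberCurve n).IsElliptic] (D : GenusPointData n)
    {R : (congruentNumberCurve n).toAffine.Point} (hRnt : ¬ IsOfFinAddOrder R) {Q₁ : APoint D.H}
    (hQ₁ : φH D Q₁ = Point.map (W' := curveA.twoIsogenyCodomain)
      (D.embK n (Nat.mem_divisors_self n hsq.ne_zero)) (ΘE hsq.ne_zero R)) :
    ¬ IsOfFinAddOrder Q₁ := by
  intro hQ
  apply hRnt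
  have h1 : IsOfFinAddOrder (Point.map (W' := curveA.twoIsogenyCodomain)
      (D.embK n (Nat.mem_divisors_self n hsq.ne_zero)) (ΘE hsq.ne_zero R)) := by
    rw [← hQ₁]; exact (φH D).isOfFinAddOrder hQ
  have h2 : IsOfFinAddOrder (ΘE hsq.ne_zero R) :=
    ((Point.map_injective (W' := curveA.twoIsogenyCodomain) _).isOfFinAddOrder_iff).mp h1
  exact ((ΘE_injective hsq.ne_zero).isOfFinAddOrder_iff).mp h2

/-- **THEOREM 3.5's MAIN CLAUSE WITHOUT `ρ(n)` AND WITHOUT `α_n`.** Square-free `n` with `rank E_n(ℚ) ≤ 1`; data `D` with the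
displayed main clause of Thm 3.5 (`h35`) and `𝓛(n) ≠ 0` (the data's sign choice `D.scriptL n`); `R` a generator of `E_n(ℚ)`
modulo torsion; `Q₁ ∈ A(ℍ′_n)` ANY point with `φ_H(Q₁) = ι Θ_E(R)`.  Then **`2·P(n) − (u·𝓛(n))·Q₁` has finite order for a
sign `u = ±1`.**  (Printed: `2^{1+ρ}·P(n) − s·𝓛(n)·α_n ∈ tors`; `α_n ≡ ±Θ_A(α₀)` for the generator `α₀` of `A_n′(ℚ)`, and
`ι Θ_A(α₀) ≡ ±2^ρ·Q₁` by the half relation; the factor `2^ρ` cancels.)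
[cite: TianYuanZhang2017, Thm. 3.5 (chunk p0011 L94–L100), §3.1 (p0011 L27–L36), §1 (p0002 L101–L110)] [cite: SilvermanAEC2009, Prop. X.4.9] -/
theorem two_smul_genusPoint_sub_smul_half_isOfFinAddOrder (hsq : Squarefree n) [(congruentNumberCurve n).IsElliptic]
    (hr1 : (congruentNumberCurve n).mordellWeilRank ≤ 1) (D : GenusPointData n) (h35 : D.thm35Main)
    (hL0 : D.scriptL n ≠ 0)
    {R : (congruentNumberCurve n).toAffine.Point} (hR : ∀ x, ∃ k : ℤ, IsOfFinAddOrder (x - k • R))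
    {Q₁ : APoint D.H} (hQ₁ : φH D Q₁ = Point.map (W' := curveA.twoIsogenyCodomain)
      (D.embK n (Nat.mem_divisors_self n hsq.ne_zero)) (ΘE hsq.ne_zero R)) :
    ∃ u : ℤ, (u = 1 ∨ u = -1) ∧ IsOfFinAddOrder ((2 : ℤ) • D.P n - (u * D.scriptL n) • Q₁) := by
  have hn0 : n ≠ 0 := hsq.ne_zero
  have hn : n ∈ n.divisors := Nat.mem_divisors_self n hn0
  obtain ⟨ρ, hρ⟩ := stub_S3 hsq
  obtain ⟨α₀, hα₀⟩ := stub_S0' (n := n) hr1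
  obtain ⟨ε, hε, t₂, ht₂, hψα⟩ := stub_S1 hsq (ψQ n) xSqClass_eq_one_iff_exists_ψQ hρ hR hα₀
  have hgen : GeneratesFreePart n (ΘA hn0 α₀) :=
    generatesFreePart_of_twist (ΘA hn0) (map_conj_ΘA hn0) (exists_ΘA_eq hn0) hα₀
  obtain ⟨s, hs, hrel⟩ := ((h35 hn ρ hρ).2 hL0) (ΘA hn0 α₀) hgen
  have key := LevelTwoRhoValve.map_ΘA_sub_zsmul_half_isOfFinAddOrder hsq D ht₂ hψα hQ₁
  refine ⟨s * ε, ?_, ?_⟩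
  · rcases hs with rfl | rfl <;> rcases hε with rfl | rfl <;> norm_num
  · -- `2^{ρ+1} P − sL·ιΘα₀ ≡ 0`, `ιΘα₀ ≡ ε2^ρ Q₁` ⟹ `2^ρ (2P − sεL Q₁) ≡ 0`
    have h2 : IsOfFinAddOrder ((2 ^ ρ : ℕ) • ((2 : ℤ) • D.P n - (s * ε * D.scriptL n) • Q₁)) := by
      have e : (2 ^ ρ : ℕ) • ((2 : ℤ) • D.P n - (s * ε * D.scriptL n) • Q₁) =
          (((2 : ℤ) ^ (ρ + 1)) • D.P n -
            (s * D.scriptL n) • Point.map (W' := curveA) (D.embK n hn) (ΘA hn0 α₀)) +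
          (s * D.scriptL n) • (Point.map (W' := curveA) (D.embK n hn) (ΘA hn0 α₀) - (ε * 2 ^ ρ) • Q₁) := by
        rw [pow_succ]
        module
      rw [e]
      exact hrel.add key.zsmul
    exact W2.Abstract.isOfFinAddOrder_of_nsmul (pow_ne_zero ρ two_ne_zero) h2

/-- **C⁺ IN `E_n(ℚ)`-CURRENCY: `P(n)` IS AN ODD MULTIPLE OF THE HALF OF THE MORDELL–WEIL GENERATOR.** Square-free
`n ≡ 5, 6, 7 (mod 8)` with `ord_{s=1} L(E_n, s) = 1`; GZK; data `D` with Thm 3.5's displayed main clause (`h35`) and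
integrality (`hLs`); `R` a generator of `E_n(ℚ)` modulo torsion; `Q₁ ∈ A(ℍ′_n)` any point with `φ_H(Q₁) = ι Θ_E(R)`.  Then
the conclusion of C⁺ at `n` — `2 ∣ L ∧ 4 ∤ L` for every sign choice `L` of `𝓛(n)` — holds **iff `P(n) − m·Q₁ ∈ A(ℍ′_n)_tor`
for some ODD integer `m`**.  No `ρ(n)`, no `A(K_n)⁻`.
[cite: TianYuanZhang2017, Thm. 3.5 (chunk p0011 L94–L100), §3.1 (p0011 L27–L36)] [cite: Darmon2004, Thm. 3.22] -/
theorem levelTwo_iff_genusPoint_odd_multiple_half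
    (hGZK : rank_eq_analyticRank_of_analyticRank_le_one) (hsq : Squarefree n)
    (h8 : n % 8 = 5 ∨ n % 8 = 6 ∨ n % 8 = 7) (hr : (congruentNumberCurve n).analyticRank = 1)
    (D : GenusPointData n) (h35 : D.thm35Main) (hLs : D.scriptLSpec)
    {R : (congruentNumberCurve n).toAffine.Point} (hR : ∀ x, ∃ k : ℤ, IsOfFinAddOrder (x - k • R))
    {Q₁ : APoint D.H} (hQ₁ : φH D Q₁ = Point.map (W' := curveA.twoIsogenyCodomain)
      (D.embK n (Nat.mem_divisors_self n hsq.ne_zero)) (ΘE hsq.ne_zero R)) :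
    (∀ L : ℤ, IsScriptL n L → (2 : ℤ) ∣ L ∧ ¬ (4 : ℤ) ∣ L) ↔
      ∃ m : ℤ, Odd m ∧ IsOfFinAddOrder (D.P n - m • Q₁) := by
  haveI := isElliptic_congruentNumberCurve hsq.ne_zero
  have hn : n ∈ n.divisors := Nat.mem_divisors_self n hsq.ne_zero
  have hn1 : 1 < n := by rcases h8 with h | h | h <;> omega
  have hLD : IsScriptL n (D.scriptL n) := hLs n hn hn1
  have hL0 : D.scriptL n ≠ 0 := (P2.bsdp_two_congruentNumberCurve_iff_of_isScriptL hGZK hsq hr hLD).2.2.1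
  have hrank : (congruentNumberCurve n).mordellWeilRank = 1 := (hGZK _ hr.le).1.trans hr
  -- `R` is non-torsion (rank one), hence so is `Q₁`
  obtain ⟨x, hx⟩ := LevelTwo.exists_not_isOfFinAddOrder_of_one_le_rank (congruentNumberCurve n) hrank.ge
  have hRnt : ¬ IsOfFinAddOrder R := LevelTwo.not_isOfFinAddOrder_of_generates hx (hR x)
  have hQnt : ¬ IsOfFinAddOrder Q₁ := not_isOfFinAddOrder_half hsq D hRnt hQ₁
  obtain ⟨u, hu, hrel⟩ := two_smul_genusPoint_sub_smul_half_isOfFinAddOrder hsq hrank.le D h35 hL0 hR hQ₁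
  have hrel' : IsOfFinAddOrder (((2 : ℤ) ^ (0 + 1)) • D.P n - (u * D.scriptL n) • Q₁) := by simpa using hrel
  have key := LevelTwo.levelTwo_iff_of_torsionRelation hQnt hu hrel'
  simp only [pow_zero, one_smul] at key
  constructor
  · intro h
    exact key.mp (h (D.scriptL n) hLD)
  · intro hm L hL
    exact LevelTwo.two_dvd_not_four_dvd_of_eq_or_eq_neg (LevelTwo.eq_or_eq_neg_of_isScriptL hL hLD) (key.mpr hm)

/-! ## §3 Consequences: equal depth; on the visible part C⁺ ⟺ `[P(n)] = [Q₁]`; `𝓛(n)` odd ⟹ `[Q₁] = 0` -/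

/-- **C⁺ ⟹ `P(n)` and `Q₁` have the same `2`-adic depth modulo torsion** (same data): for every `k`,
`P(n) ∈ 2^k A(ℍ′_n) + A(ℍ′_n)_tor ⟺ Q₁ ∈ 2^k A(ℍ′_n) + A(ℍ′_n)_tor`.
[cite: TianYuanZhang2017, Thm. 3.5 (chunk p0011 L94–L100)] [cite: Darmon2004, Thm. 3.22] -/
theorem twoPowDivisible_iff_of_levelTwo
    (hGZK : rank_eq_analyticRank_of_analyticRank_le_one) (hsq : Squarefree n)
    (h8 : n % 8 = 5 ∨ n % 8 = 6 ∨ n % 8 = 7) (hr : (congruentNumberCurve n).analyticRank = 1)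
    (D : GenusPointData n) (h35 : D.thm35Main) (hLs : D.scriptLSpec)
    {R : (congruentNumberCurve n).toAffine.Point} (hR : ∀ x, ∃ k : ℤ, IsOfFinAddOrder (x - k • R))
    {Q₁ : APoint D.H} (hQ₁ : φH D Q₁ = Point.map (W' := curveA.twoIsogenyCodomain)
      (D.embK n (Nat.mem_divisors_self n hsq.ne_zero)) (ΘE hsq.ne_zero R))
    (hC : ∀ L : ℤ, IsScriptL n L → (2 : ℤ) ∣ L ∧ ¬ (4 : ℤ) ∣ L) (k : ℕ) :
    (∃ y : APoint D.H, IsOfFinAddOrder (D.P n - ((2 : ℤ) ^ k) • y)) ↔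
      ∃ y : APoint D.H, IsOfFinAddOrder (Q₁ - ((2 : ℤ) ^ k) • y) := by
  obtain ⟨m, hm, h⟩ := (levelTwo_iff_genusPoint_odd_multiple_half hGZK hsq h8 hr D h35 hLs hR hQ₁).mp hC
  exact twoPowDivisible_iff_of_odd_zsmul hm h k

/-- **ON THE VISIBLE PART C⁺ ⟺ `[P(n)] = [Q₁]`.** Same data, and the half `Q₁` NOT `2`-divisible in `A(ℍ′_n)` modulo torsion.
Then C⁺ at `n` holds **iff `P(n) − Q₁ ∈ 2A(ℍ′_n) + A(ℍ′_n)_tor`** (sharper than g2's `[P(n)] ≠ 0`: the two classes agree in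
`V = A(ℍ′_n)/(2A(ℍ′_n) + A(ℍ′_n)_tor)`).  (⟸: `2P ≡ uL·Q₁`; `L` odd would force `[Q₁] = 0`, so `L = 2m`, `P ≡ um·Q₁`,
and `[P] = [Q₁] ≠ 0` forces `m` odd.) [cite: TianYuanZhang2017, Thm. 3.5 (chunk p0011 L94–L100)] [cite: Darmon2004, Thm. 3.22] -/
theorem levelTwo_iff_genusPoint_sub_half_twoDivisible
    (hGZK : rank_eq_analyticRank_of_analyticRank_le_one) (hsq : Squarefree n)
    (h8 : n % 8 = 5 ∨ n % 8 = 6 ∨ n % 8 = 7) (hr : (congruentNumberCurve n).analyticRank = 1)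
    (D : GenusPointData n) (h35 : D.thm35Main) (hLs : D.scriptLSpec)
    {R : (congruentNumberCurve n).toAffine.Point} (hR : ∀ x, ∃ k : ℤ, IsOfFinAddOrder (x - k • R))
    {Q₁ : APoint D.H} (hQ₁ : φH D Q₁ = Point.map (W' := curveA.twoIsogenyCodomain)
      (D.embK n (Nat.mem_divisors_self n hsq.ne_zero)) (ΘE hsq.ne_zero R))
    (hQ2 : ¬ ∃ y : APoint D.H, IsOfFinAddOrder (Q₁ - (2 : ℤ) • y)) :
    (∀ L : ℤ, IsScriptL n L → (2 : ℤ) ∣ L ∧ ¬ (4 : ℤ) ∣ L) ↔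
      ∃ y : APoint D.H, IsOfFinAddOrder (D.P n - Q₁ - (2 : ℤ) • y) := by
  haveI := isElliptic_congruentNumberCurve hsq.ne_zero
  have hn : n ∈ n.divisors := Nat.mem_divisors_self n hsq.ne_zero
  have hn1 : 1 < n := by rcases h8 with h | h | h <;> omega
  have hLD : IsScriptL n (D.scriptL n) := hLs n hn hn1
  have hL0 : D.scriptL n ≠ 0 := (P2.bsdp_two_congruentNumberCurve_iff_of_isScriptL hGZK hsq hr hLD).2.2.1
  have hrank : (congruentNumberCurve n).mordellWeilRank = 1 := (hGZK _ hr.le).1.trans hr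
  rw [levelTwo_iff_genusPoint_odd_multiple_half hGZK hsq h8 hr D h35 hLs hR hQ₁]
  constructor
  · rintro ⟨m, hm, h⟩
    exact sub_twoDivisible_of_odd_zsmul hm h
  · rintro ⟨y, hy⟩
    obtain ⟨u, hu, hrel⟩ := two_smul_genusPoint_sub_smul_half_isOfFinAddOrder hsq hrank.le D h35 hL0 hR hQ₁
    have hu2 : u * u = 1 := by rcases hu with rfl | rfl <;> norm_num
    -- `L` is even: otherwise `Q₁ ∈ 2A + tors`
    rcases Int.even_or_odd (D.scriptL n) with ⟨m, hm⟩ | hodd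
    · -- `L = m + m`: `P ≡ (u m) Q₁`, and `[P] = [Q₁]` forces `u m` odd
      have hPm : IsOfFinAddOrder (D.P n - (u * m) • Q₁) := by
        have e : (2 : ℤ) • D.P n - (u * D.scriptL n) • Q₁ = (2 : ℤ) • (D.P n - (u * m) • Q₁) := by
          rw [hm]; module
        rw [e, show ((2 : ℤ) • (D.P n - (u * m) • Q₁)) = (2 : ℕ) • (D.P n - (u * m) • Q₁) from by norm_cast]
          at hrel
        exact W2.Abstract.isOfFinAddOrder_of_two_nsmul hrel
      refine ⟨u * m, ?_, hPm⟩
      rcases Int.even_or_odd (u * m) with ⟨j, hj⟩ | hodd'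
      · -- then `Q₁ − 2·(y − j Q₁)` torsion: contradiction
        exfalso
        apply hQ2
        refine ⟨j • Q₁ - y, ?_⟩
        have e : Q₁ - (2 : ℤ) • (j • Q₁ - y) = -(D.P n - Q₁ - (2 : ℤ) • y) + (D.P n - (u * m) • Q₁) := by
          rw [hj]; module
        rw [e]
        exact hy.neg.add hPm
      · exact hodd'
    · exfalso
      apply hQ2
      have hodd' : Odd (u * D.scriptL n) := by
        rcases hu with rfl | rfl
        · simpa using hodd
        · simpa using hodd.neg
      exact LevelTwoModTwo.exists_sub_two_zsmul_of_odd hodd' hrel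

/-- **`𝓛(n)` ODD ⟹ THE HALF `Q₁` IS `2`-DIVISIBLE modulo torsion** (square-free `n`, `rank E_n(ℚ) ≤ 1`, Thm 3.5's displayed main
clause): from `2·P(n) ≡ ±𝓛(n)·Q₁`.  So the families on which Tian–Yuan–Zhang PROVE `𝓛(n)` odd lie in the hidden part
`[Q₁] = 0` of this bookkeeping — consistently: there `2 ∥ 𝓛` is false and C⁺ does not claim them (`s(n) = 3` excludes them).
[cite: TianYuanZhang2017, Thm. 3.5 (chunk p0011 L94–L100), Thm. 1.2 (p0002 L112–L127)] -/
theorem half_twoDivisible_of_odd_scriptL (hsq : Squarefree n) [(congruentNumberCurve n).IsElliptic]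
    (hr1 : (congruentNumberCurve n).mordellWeilRank ≤ 1) (D : GenusPointData n) (h35 : D.thm35Main)
    (hodd : Odd (D.scriptL n))
    {R : (congruentNumberCurve n).toAffine.Point} (hR : ∀ x, ∃ k : ℤ, IsOfFinAddOrder (x - k • R))
    {Q₁ : APoint D.H} (hQ₁ : φH D Q₁ = Point.map (W' := curveA.twoIsogenyCodomain)
      (D.embK n (Nat.mem_divisors_self n hsq.ne_zero)) (ΘE hsq.ne_zero R)) :
    ∃ y : APoint D.H, IsOfFinAddOrder (Q₁ - (2 : ℤ) • y) := by
  have hL0 : D.scriptL n ≠ 0 := by obtain ⟨j, hj⟩ := hodd; omega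
  obtain ⟨u, hu, hrel⟩ := two_smul_genusPoint_sub_smul_half_isOfFinAddOrder hsq hr1 D h35 hL0 hR hQ₁
  have hodd' : Odd (u * D.scriptL n) := by
    rcases hu with rfl | rfl
    · simpa using hodd
    · simpa using hodd.neg
  exact LevelTwoModTwo.exists_sub_two_zsmul_of_odd hodd' hrel

/-- **C⁺ ⟹ `[P(n)] = [Q₁]` in `V`** (same data as `levelTwo_iff_genusPoint_odd_multiple_half`, no visibility hypothesis): the
conclusion of C⁺ at `n` puts the genus point and the half of the Mordell–Weil generator in the same class of
`A(ℍ′_n)/(2A(ℍ′_n) + A(ℍ′_n)_tor)`. [cite: TianYuanZhang2017, Thm. 3.5 (chunk p0011 L94–L100)] [cite: Darmon2004, Thm. 3.22] -/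
theorem genusPoint_sub_half_twoDivisible_of_levelTwo
    (hGZK : rank_eq_analyticRank_of_analyticRank_le_one) (hsq : Squarefree n)
    (h8 : n % 8 = 5 ∨ n % 8 = 6 ∨ n % 8 = 7) (hr : (congruentNumberCurve n).analyticRank = 1)
    (D : GenusPointData n) (h35 : D.thm35Main) (hLs : D.scriptLSpec)
    {R : (congruentNumberCurve n).toAffine.Point} (hR : ∀ x, ∃ k : ℤ, IsOfFinAddOrder (x - k • R))
    {Q₁ : APoint D.H} (hQ₁ : φH D Q₁ = Point.map (W' := curveA.twoIsogenyCodomain)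
      (D.embK n (Nat.mem_divisors_self n hsq.ne_zero)) (ΘE hsq.ne_zero R))
    (hC : ∀ L : ℤ, IsScriptL n L → (2 : ℤ) ∣ L ∧ ¬ (4 : ℤ) ∣ L) :
    ∃ y : APoint D.H, IsOfFinAddOrder (D.P n - Q₁ - (2 : ℤ) • y) := by
  obtain ⟨m, hm, h⟩ := (levelTwo_iff_genusPoint_odd_multiple_half hGZK hsq h8 hr D h35 hLs hR hQ₁).mp hC
  exact sub_twoDivisible_of_odd_zsmul hm h

end EnSide

end Summit.BirchSwinnertonDyer.PrintCf2.LevelTwoHalfGenerator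

end
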